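/-
Copyright (c) 2026 the pub-hodgecm-mathlib formalisation cell (harness21).  Prover seat hodgecm-mathlib-K2E4-p10 (g5), Track B ∕ K2-LIT, h413 =
`stmt-HodgeConjecture-24833`, ENGINE E1, campaign «EIS-WHITTAKER-3», WAVE 2 letter «W-hWbd₃» (dealer K2E1-plan (g5) DEAL (4) 2026-09-04T08:27:09Z, plan «=» 08:28:25Z),
brick «DEN-BOUNDS-UNIFORM₃»: the Whittaker normaliser `D^S(z)⁻¹ = [ζ^S_F(z)·L^S(z,ε)·L^S(2z−1,ε)]⁻¹` is bounded UNIFORMLY in the omitted set `S` on every closed half-plane `Re z ≥ x₁ > 1`.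
-/
import Summits.HodgeConjecture.HodgeConjecture.Theorems.K2E1WhittakerCoefficientEulerProductU3   -- ★ p858568 W3₃ FILE A (this seat): `hasProd_unitDen_inv` (`∏_{v∉S} unit_v = D^S(z)⁻¹`), CM frame
import Summits.HodgeConjecture.HodgeConjecture.Theorems.K2E1WhittakerBoundsUniformU2            -- ★ p858401 #1b (K2E2-p12 g5): the N = 2 template `norm_inv_partialZeta_le_uniform` (§1)
import HarnessLib

/-!
# K2·E1 — `K2E1WhittakerDenBoundsUniformU3` («EIS-WHITTAKER-3», «W-hWbd₃» brick «DEN-BOUNDS-UNIFORM₃»): `‖[ζ^S_F(z)·L^S(z,ε)·L^S(2z−1,ε)]⁻¹‖ ≤ exp(3·Σ_v q_v^{−x₁})` FOR `Re z ≥ x₁ > 1`,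
# UNIFORMLY IN THE OMITTED SET `S` — so the `ξ`-dependent normaliser `D^{S_ξ}(z)⁻¹` of the `U(2,1)` Whittaker coefficient is harmless in `hWbd`

Track B ∕ K2-LIT, crux h413 = `stmt-HodgeConjecture-24833`, route of record `HCCMUnconditional`; cell `hodgecm-mathlib`, squad K2, ENGINE E1 (campaign «EIS-WHITTAKER-3», WAVE 2).
Prover seat `hodgecm-mathlib-K2E4-p10` (g5).  THEOREMS ONLY (no `def`, no `instance`, no notation, no named-fact hypothesis, no `sorry`; default heartbeats); lane
`--supports stmt-HodgeConjecture-24833 --as helper` (count-neutral).  Closes no socket.  GENERIC number field `F`, unitary Hecke character `ε`; then the CM frame.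

THE MATHEMATICS [NeukirchANT1999, Ch. VII (5.2); MoeglinWaldspurger1995, I.2.10; Garrett2018, §2.8].  The N = 3 twin of ★ #1b `norm_inv_partialZeta_le_uniform`: by ★ W3₃ FILE A
`hasProd_unitDen_inv`, `D^S(z)⁻¹` is the `HasProd`-value of the unit values `v ∉ S ↦ (1 − q_v^{−z})(1 − ε_v q_v^{−z})(1 − ε_v q_v^{−(2z−1)})`; each factor has norm
`≤ (1 + q_v^{−x₁})³ ≤ exp(3 q_v^{−x₁})` for `Re z ≥ x₁ ≥ 1` (`‖ε_v‖ ≤ 1`, `Re(2z−1) ≥ 2x₁ − 1 ≥ x₁`), so every partial product has norm `≤ exp(3·Σ_v q_v^{−x₁})` (`x₁ > 1`: ★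
`summable_residueCard_rpow_neg`) — a bound free of `S`, of the partial product and of `z`; norms pass to the limit (`le_of_tendsto'`).
* §1 `norm_one_sub_mul_residueCard_cpow_neg_le_exp` (one twisted factor), `norm_unitDen_le_exp` (one place, the triple), `norm_prod_unitDen_le` (partial products).
* §2 HEAD **`norm_den_inv_le_uniform`**: for `x₁ > 1` ONE `C > 0` with `‖D^S(z)⁻¹‖ ≤ C` for EVERY set `S` and every `z` with `Re z ≥ x₁`; §3 `norm_den_inv_le_uniform_cm` at `F = L⁺`, `ε = ε_{L∕L⁺}`.
HONEST LABEL: HC_CM is proved only modulo the 7 printed citations (2 remaining named inputs: hLiu418 = `stmt-HodgeConjecture-24832`, h413 = `stmt-HodgeConjecture-24833`) until rung 0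
closes; this file asserts no named fact and closes no socket; count-neutral.

## References
* [NeukirchANT1999] J. Neukirch, *Algebraic Number Theory* (1999): Ch. VII (5.2) (Euler products of Hecke `L`-series, absolute convergence on `Re > 1`).
* [MoeglinWaldspurger1995] C. Mœglin, J.-L. Waldspurger, *Spectral Decomposition and Eisenstein Series* (1995): I.2.10.
* [Garrett2018] P. Garrett, *Modern Analysis of Automorphic Forms by Example* 1 (2018): §2.8.
-/

set_option autoImplicit false
set_option linter.dupNamespace false -- the mandated namespace repeats `HodgeConjecture.HodgeConjecture`

noncomputable section

open scoped NNReal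
open Filter Topology Complex NumberField IsDedekindDomain
open Literature.NumberTheory.Automorphic Literature.NumberTheory.LFunctions Literature.NumberTheory.GaloisRepresentations
open Summit.HodgeConjecture.HodgeConjecture.Cruxes.H413.F0P2wPartialDedekindZetaPole (norm_residueCard_cpow_neg_le)
open Summit.HodgeConjecture.HodgeConjecture.Cruxes.H413.K2E1WhittakerCoefficientEulerProductU3 (hasProd_unitDen_inv isUnitary_quadraticHeckeCharCM)

namespace Summit.HodgeConjecture.HodgeConjecture.Cruxes.H413.K2E1WhittakerDenBoundsUniformU3

section General

variable {F : Type} [Field F] [NumberField F] {ε : HeckeCharacter F}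

/-! ## §1 One place: `‖(1 − q^{−z})(1 − ε_v q^{−z})(1 − ε_v q^{−(2z−1)})‖ ≤ exp(3·q_v^{−x₁})` for `Re z ≥ x₁ ≥ 1`, `‖ε_v‖ ≤ 1` -/

/-- One twisted factor: `‖1 − c·q_v^{−w}‖ ≤ exp(q_v^{−x₁})` for `‖c‖ ≤ 1`, `x₁ ≤ Re w`. [cite: NeukirchANT1999, Ch. VII (5.2)] -/
theorem norm_one_sub_mul_residueCard_cpow_neg_le_exp (v : HeightOneSpectrum (𝓞 F)) {c : ℂ} (hc : ‖c‖ ≤ 1) {x₁ : ℝ} {w : ℂ} (hw : x₁ ≤ w.re) :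
    ‖1 - c * (v.residueCard : ℂ) ^ (-w)‖ ≤ Real.exp ((v.residueCard : ℝ) ^ (-x₁)) := by
  have hq : ‖(v.residueCard : ℂ) ^ (-w)‖ ≤ (v.residueCard : ℝ) ^ (-x₁) := norm_residueCard_cpow_neg_le v hw
  calc ‖1 - c * (v.residueCard : ℂ) ^ (-w)‖ ≤ ‖(1 : ℂ)‖ + ‖c * (v.residueCard : ℂ) ^ (-w)‖ := norm_sub_le _ _
    _ ≤ 1 + (v.residueCard : ℝ) ^ (-x₁) := by
        rw [norm_one, norm_mul]
        exact add_le_add le_rfl ((mul_le_of_le_one_left (norm_nonneg _) hc).trans hq)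
    _ ≤ Real.exp ((v.residueCard : ℝ) ^ (-x₁)) := by rw [add_comm]; exact Real.add_one_le_exp _

/-- **One place, the triple**: `‖(1 − q_v^{−z})(1 − ε_v q_v^{−z})(1 − ε_v q_v^{−(2z−1)})‖ ≤ exp(3·q_v^{−x₁})` for `ε` unitary and `1 ≤ x₁ ≤ Re z` (`Re(2z−1) = 2Re z − 1 ≥ x₁`).
[cite: NeukirchANT1999, Ch. VII (5.2)] -/
theorem norm_unitDen_le_exp (hε : ε.IsUnitary) (v : HeightOneSpectrum (𝓞 F)) {x₁ : ℝ} (hx₁ : 1 ≤ x₁) {z : ℂ} (hz : x₁ ≤ z.re) :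
    ‖(1 - (v.residueCard : ℂ) ^ (-z)) * (1 - ε.valueAtUniformizer v * (v.residueCard : ℂ) ^ (-z)) *
        (1 - ε.valueAtUniformizer v * (v.residueCard : ℂ) ^ (-(2 * z - 1)))‖ ≤ Real.exp (3 * (v.residueCard : ℝ) ^ (-x₁)) := by
  have hεv : ‖ε.valueAtUniformizer v‖ ≤ 1 := (HeckeCharacter.norm_valueAtUniformizer_of_isUnitary hε v).le
  have h2 : x₁ ≤ (2 * z - 1).re := by
    have : (2 * z - 1).re = 2 * z.re - 1 := by simp [Complex.mul_re]
    rw [this]; linarith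
  have ha : ‖(1 : ℂ) - (v.residueCard : ℂ) ^ (-z)‖ ≤ Real.exp ((v.residueCard : ℝ) ^ (-x₁)) := by
    simpa only [one_mul] using norm_one_sub_mul_residueCard_cpow_neg_le_exp v (c := 1) (by rw [norm_one]) hz
  have hb := norm_one_sub_mul_residueCard_cpow_neg_le_exp v hεv hz
  have hc := norm_one_sub_mul_residueCard_cpow_neg_le_exp v hεv h2
  rw [norm_mul, norm_mul, show (3 : ℝ) * (v.residueCard : ℝ) ^ (-x₁) = (v.residueCard : ℝ) ^ (-x₁) + (v.residueCard : ℝ) ^ (-x₁) + (v.residueCard : ℝ) ^ (-x₁) by ring,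
    Real.exp_add, Real.exp_add]
  exact mul_le_mul (mul_le_mul ha hb (norm_nonneg _) (Real.exp_nonneg _)) hc (norm_nonneg _) (mul_nonneg (Real.exp_nonneg _) (Real.exp_nonneg _))

/-- **Partial products**: for every finite set `T` of places off `S`, `ε` unitary, `1 < x₁ ≤ Re z`:
`‖∏_{v∈T} (1 − q_v^{−z})(1 − ε_v q_v^{−z})(1 − ε_v q_v^{−(2z−1)})‖ ≤ exp(3·Σ_v q_v^{−x₁})` — free of `T`, `S`, `z` (★ `summable_residueCard_rpow_neg`). [cite: NeukirchANT1999, Ch. VII (5.2)] -/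
theorem norm_prod_unitDen_le (hε : ε.IsUnitary) {x₁ : ℝ} (hx₁ : 1 < x₁) (S : Set (HeightOneSpectrum (𝓞 F))) {z : ℂ} (hz : x₁ ≤ z.re)
    (T : Finset {v : HeightOneSpectrum (𝓞 F) // v ∉ S}) :
    ‖∏ v ∈ T, ((1 - (v.1.residueCard : ℂ) ^ (-z)) * (1 - ε.valueAtUniformizer v.1 * (v.1.residueCard : ℂ) ^ (-z)) *
        (1 - ε.valueAtUniformizer v.1 * (v.1.residueCard : ℂ) ^ (-(2 * z - 1))))‖ ≤
      Real.exp (3 * ∑' v : HeightOneSpectrum (𝓞 F), (v.residueCard : ℝ) ^ (-x₁)) := by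
  have hsum := summable_residueCard_rpow_neg (K := F) hx₁
  calc ‖∏ v ∈ T, ((1 - (v.1.residueCard : ℂ) ^ (-z)) * (1 - ε.valueAtUniformizer v.1 * (v.1.residueCard : ℂ) ^ (-z)) *
          (1 - ε.valueAtUniformizer v.1 * (v.1.residueCard : ℂ) ^ (-(2 * z - 1))))‖
      = ∏ v ∈ T, ‖(1 - (v.1.residueCard : ℂ) ^ (-z)) * (1 - ε.valueAtUniformizer v.1 * (v.1.residueCard : ℂ) ^ (-z)) *
          (1 - ε.valueAtUniformizer v.1 * (v.1.residueCard : ℂ) ^ (-(2 * z - 1)))‖ := norm_prod _ _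
    _ ≤ ∏ v ∈ T, Real.exp (3 * (v.1.residueCard : ℝ) ^ (-x₁)) :=
        Finset.prod_le_prod (fun _ _ => norm_nonneg _) fun v _ => norm_unitDen_le_exp hε v.1 hx₁.le hz
    _ = Real.exp (∑ v ∈ T, 3 * (v.1.residueCard : ℝ) ^ (-x₁)) := by rw [Real.exp_sum]
    _ ≤ Real.exp (3 * ∑' v : HeightOneSpectrum (𝓞 F), (v.residueCard : ℝ) ^ (-x₁)) := by
        refine Real.exp_le_exp.2 ?_
        rw [← Finset.mul_sum]
        refine mul_le_mul_of_nonneg_left ?_ (by norm_num)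
        calc ∑ v ∈ T, (v.1.residueCard : ℝ) ^ (-x₁)
            ≤ ∑' v : {v : HeightOneSpectrum (𝓞 F) // v ∉ S}, (v.1.residueCard : ℝ) ^ (-x₁) :=
              (hsum.subtype _).sum_le_tsum T fun v _ => by positivity
          _ ≤ ∑' v : HeightOneSpectrum (𝓞 F), (v.residueCard : ℝ) ^ (-x₁) :=
              hsum.tsum_subtype_le (fun v : HeightOneSpectrum (𝓞 F) => (v.residueCard : ℝ) ^ (-x₁)) _ fun v => by positivity

/-! ## §2 HEAD: the uniform bound of the inverse denominator -/

/-- **UNIFORM INVERSE DENOMINATOR BOUND.**  For `ε` unitary and `x₁ > 1` there is ONE constant `C > 0` (`C = exp(3·Σ_v q_v^{−x₁})`) such that for EVERY set `S` of finite places of `F`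
(finite or not) and every `z` with `Re z ≥ x₁`:  `‖[ζ^S_F(z)·L^S(z,ε)·L^S(2z−1,ε)]⁻¹‖ ≤ C` — the `ξ`-dependent normaliser `D^{S_ξ}(z)⁻¹` of the `U(2,1)` Whittaker coefficient (★ W3₃ FILE A)
is bounded on closed vertical half-planes inside the window, uniformly in `ξ`.  Proof: `D^S(z)⁻¹` is the `HasProd`-value of the unit values (★ `hasProd_unitDen_inv`) and every partial
product has norm `≤ C` (§1); norms pass to the limit. [cite: NeukirchANT1999, Ch. VII (5.2)] [cite: MoeglinWaldspurger1995, I.2.10] -/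
theorem norm_den_inv_le_uniform (hε : ε.IsUnitary) {x₁ : ℝ} (hx₁ : 1 < x₁) :
    ∃ C : ℝ, 0 < C ∧ ∀ (S : Set (HeightOneSpectrum (𝓞 F))) (z : ℂ), x₁ ≤ z.re →
      ‖(partialStandardL S (fun _ => ({1} : Multiset ℂ)) z * partialStandardL S (fun v => {ε.valueAtUniformizer v}) z *
          partialStandardL S (fun v => {ε.valueAtUniformizer v}) (2 * z - 1))⁻¹‖ ≤ C := by
  refine ⟨Real.exp (3 * ∑' v : HeightOneSpectrum (𝓞 F), (v.residueCard : ℝ) ^ (-x₁)), Real.exp_pos _, fun S z hz => ?_⟩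
  have hz1 : 1 < z.re := lt_of_lt_of_le hx₁ hz
  have h := (hasProd_unitDen_inv hε S hz1).1
  unfold HasProd at h
  rw [SummationFilter.unconditional_filter] at h
  exact le_of_tendsto' h.norm fun T => norm_prod_unitDen_le hε hx₁ S hz T

/-- **The same, quantified as W-hWbd₃ reads it**: for `x₁ > 1` a single `C` bounds `‖D^S(z)⁻¹‖` on the closed half-plane `{x₁ ≤ Re z}` for all `S` AT ONCE (so the strip ∩ box
neighbourhoods `V` of ★ W4's `hWbd` may take `C` independent of the frequency). [cite: MoeglinWaldspurger1995, I.2.10] [cite: Garrett2018, §2.8] -/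
theorem exists_forall_norm_den_inv_le (hε : ε.IsUnitary) {x₁ : ℝ} (hx₁ : 1 < x₁) :
    ∃ C : ℝ, 0 < C ∧ ∀ z : ℂ, x₁ ≤ z.re → ∀ S : Set (HeightOneSpectrum (𝓞 F)),
      ‖(partialStandardL S (fun _ => ({1} : Multiset ℂ)) z * partialStandardL S (fun v => {ε.valueAtUniformizer v}) z *
          partialStandardL S (fun v => {ε.valueAtUniformizer v}) (2 * z - 1))⁻¹‖ ≤ C := by
  obtain ⟨C, hC, h⟩ := norm_den_inv_le_uniform hε hx₁
  exact ⟨C, hC, fun z hz S => h S z hz⟩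

end General

/-! ## §3 The CM frame `F = L⁺`, `ε = ε_{L∕L⁺}` -/

section CM

variable (L : Type) [Field L] [NumberField L] [IsCMField L]

/-- **DEN-BOUNDS-UNIFORM₃ AT THE CM FRAME**: for `x₁ > 1` ONE `C > 0` with `‖[ζ^S_{L⁺}(z)·L^S(z,ε_{L∕L⁺})·L^S(2z−1,ε_{L∕L⁺})]⁻¹‖ ≤ C` for every set `S` of finite places of `L⁺` and every
`z` with `Re z ≥ x₁` (`ε_{L∕L⁺}` unitary ★ `isUnitary_quadraticHeckeCharCM`). [cite: NeukirchANT1999, Ch. VII (5.2)] [cite: MoeglinWaldspurger1995, I.2.10] -/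
theorem norm_den_inv_le_uniform_cm {x₁ : ℝ} (hx₁ : 1 < x₁) :
    ∃ C : ℝ, 0 < C ∧ ∀ (S : Set (HeightOneSpectrum (𝓞 ↥(maximalRealSubfield L)))) (z : ℂ), x₁ ≤ z.re →
      ‖(partialStandardL S (fun _ => ({1} : Multiset ℂ)) z * partialStandardL S (fun v => {(quadraticHeckeCharCM L).valueAtUniformizer v}) z *
          partialStandardL S (fun v => {(quadraticHeckeCharCM L).valueAtUniformizer v}) (2 * z - 1))⁻¹‖ ≤ C :=
  norm_den_inv_le_uniform (isUnitary_quadraticHeckeCharCM L) hx₁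

end CM

end Summit.HodgeConjecture.HodgeConjecture.Cruxes.H413.K2E1WhittakerDenBoundsUniformU3

end
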